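import Literature.MathematicalPhysics.QuantumFieldTheory.Balaban1983to89.B7Prop5Flat

/-!
# Spine/NE7/QLaFlatAveragingL1 — the ℓ¹ ∕ SEGMENT form of [Balaban1985Averaging] Proposition 5 (156) AT THE FLAT
# BACKGROUND, for the B7 fold's CONCRETE `k`-fold double-bar averaging `Q_k(1, ·) = B7Prop4Flat.logIter` on `ℤ^d`:
# `‖Q_k(1, B)(c)‖ ≤ (1 + C₃L^k b) · L^{(1−d)k} · Σ_b ‖B_b‖` — NODE S's per-coarse-bond deviation shape `BondDevBound`
# (file 8 `QLaHolonomyDefect` §1b) with `θ = L^{1−d}`, IN THE B7 FOLD'S COORDINATES, PROVED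

Cell `pub-balaban-gaps` (YM blitz Y1, track G2, seat `ne7`, generation 5); text of record
`run/shared/lean/pub/pub-balaban-gaps/ne/NE7.md` v5 §4sexies, census row R39 → A (half (a)).  Eleventh `Spine/NE7/` file.

WHY.  Generation 4 re-based NODE S (= (QL-a)∣_{U=1}, the one located slice of NE7's shared unprinted item) on the
holonomy-level shape `HolDevBound` ⇐ `BondDevBound av dom Cb θ` («in a coarse gauge, every bond variable of `avgⁿ V` is
within `Cb · tv(1, V) · θⁿ` of the identity», file 8 §1b) and recorded that the PRINTED source of that shape — the per-entry
Jacobian bound [Balaban1985Averaging] Prop. 5 (156) p. 42 with the normalisation (138) p. 39 — is a KERNEL THEOREM of the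
tree's B7 fold for Bałaban's concrete averaging at the flat background: `B7Prop5Flat.prop5_flat_156_B` (cell `lit-balaban`,
lineage b07; per bond, as a bound on the single-bond differentials (137) of `B ↦ Q_k(1, B)(c)` on the polydisc
`sup_b ‖B_b‖ ≤ b`, `C₃(d, L)·L^k·b ≤ 1`).  What separates a per-ENTRY derivative bound from the per-coarse-bond DEVIATION
bound NODE S consumes is the passage «integrate along a path from the flat configuration and sum over the fine bonds of the
support» — half (a) of the bridge the `pub-balaban-gaps` lead chartered to seat g2-p6 ([LEAD-G5-OPS-G2SEATS],
[LEAD-G6-RULINGS-1] R-2; g2-p6 not minted at 2026-08-23T01:50Z, first refusal ne7).  THIS FILE does (a) for the B7 fold's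
own objects, with no hypothesis beyond b07's displayed smallness: one fine bond at a time (so that only LINE derivatives
are needed — exactly what `prop5_flat_156_B` provides), the mean-value inequality on the real segment `t ∈ [0, 1] ↦
Q_k(1, B′ + t·X·δ_b)(c)` inside the polydisc, and `Q_k(1, 0) = 0` (`B7Prop4Flat.logIter_zero_field`).  RESULT (§3):
for `B` vanishing off a finite bond set `Λ`,

  `‖Q_k(1, B)(c)‖ ≤ (L^k·L^{−kd} + C₃(L^k)²L^{−kd}b) · Σ_{b ∈ Λ} ‖B_b‖ = (1 + C₃L^kb) · L^{(1−d)k} · Σ_{b∈Λ} ‖B_b‖`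

at EVERY coarse bond `c`, uniformly in `k` (`norm_logIter_le_l1`; LOCAL version `norm_logIter_le_l1_local`: the sum runs
only over the bonds of `Λ` INSIDE the box `B^k(c₋) ∪ B^k(c₊)` of `c`, by b07's locality theorem `logIter_congr` — coarse
bonds whose box misses the support do not move at all) — the ℓ¹ form («row maximum of the Jacobian × ℓ¹ norm of the
perturbation»),
to be compared with the sup form (131)∕`B7Prop5FlatOperator` (`‖Q_k(1,B)(c)‖ ≤ 2L^kb`, row SUM × sup norm), which is
useless for a perturbation supported on few bonds: for `|Λ|` bonds each within `D` of zero the deviation of every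
`k`-fold averaged bond variable is `≤ 2·|Λ|·D·L^{(1−d)k}` (§3, `norm_logIter_le_card_mul`), DECAYING at NE1a's printed
rate `θ₁ = L^{1−d}` per step (`= L⁻³` in `d = 4`, NODE S's `a = θ₁²·L⁴ = L⁻²`, files 5∕10).  §4 reads it on the group:
the averaged bond variable ITSELF, `U̿₁^k(c) = exp Q_k(1, B)(c)` (b07's `dbavgIter_eq_expCfg_logIter`), is within twice
that of the identity; §5 is the printed normalisation: `‖Q_k(U₀, ηA)(c)‖ ≤ (1 + C₃a)·Σ_b η^d‖A_b‖` (`U₀ = 1`, `η = L^{−k}`,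
`sup|A| ≤ a`, `C₃a ≤ 1`) — (156)'s constant times the `η^d`-weighted ℓ¹ norm of `A`, i.e. (156) + (138) summed.

WHERE THE COARSE GAUGE WENT.  File 8's `BondDevBound` quantifies `∃ u` (a coarse gauge transformation); here none appears
because b07's `dbavg` IS the double-bar average (89) `V̿₁(c) = v(c₋)⁻¹ V̄₁(c) v(c₊)` — the plain block average (42)∕(15)
CONJUGATED BY THE BLOCK FRAMES `v` of (110), which are exactly that coarse gauge transformation (`B7Prop3Flat.bavg_eq_conj_dbavg`;
at first order `B7Prop3Flat.frame_cancellation`: the tree-contour terms cancel against the frames, leaving the straight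
segments (125) — the abelian mechanism of file 10 `QLaAbelianBlockContraction`, «staircase means = the coarse gauge»).

WHAT IS LEFT OF THE BRIDGE (half (b), g2-p6's if minted; NOT done here): the dictionary from the B7 fold's objects (`ℤ^d`,
corner-based blocks, `𝔸`-valued logarithmic coordinates, `dbavgIter`) to the torus vocabulary `Setup.Averaging P j G` ∕
`GaugeField` ∕ `bdist` ∕ `tv` of files 5–10 (DIVERGENCES F3∕F6 of the `pub-balaban` cell: periodisation, corner ↔ centre);
the abstract half of that passage («a framed one-bond Lipschitz bound on a box domain family ⟹ `BondDevBound`») is file 12.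

HONEST FRAMING.  A theorem about the B7 fold's concrete model of [Balaban1985Averaging] (15)∕(89)∕(127) AT THE FLAT
BACKGROUND `U₀ = 1` on `ℤ^d` (b07's DIVERGENCES (a)–(e) inherited verbatim: flat background only, `𝔸` a complete normed
`ℂ`-algebra standing for `M_N(ℂ)`, `t ∈ ℂ` lines, global sup bound, un-normalised `B`-variables); the curved background
(139)∕(143) with `C′₁α₀`, Bałaban's (158)-box domains and the torus are NOT treated; nothing of the paper is asserted beyond
what b07 proved.  [folklore] bookkeeping (telescoping + mean value) over a kernel theorem; (QL-a) NOT IN PRINT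
([Balaban1989LargeFieldII] p. 356 defers observables); NE7 NOT proved; spine 0∕9; fixed finite T⁴ — NOT ℝ⁴, NOT infinite
volume, NOT a mass gap, NOT Clay.  Census effect (NE7.md v5): R39 half (a) → A (kernel); NODE S's analytic inputs at `U = 1`
are now ALL kernel theorems (criticality p342645; (156) per entry b07; (156) summed — this file) modulo the dictionary (b)
and NODE O's format (W-fmt@1).
-/

noncomputable section

open scoped BigOperators
open NormedSpace Finset Set

namespace Summit.QuantumFields.BalabanUV.T4Continuum.Spine.NE7.B7Flat

open Literature.MathematicalPhysics.QuantumFieldTheory.Balaban1983to89.B7Prop1Explicit (Site e expUnit val_expUnit)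
open Literature.MathematicalPhysics.QuantumFieldTheory.Balaban1983to89.B7Prop1Local (InBox AgreeOn loK bondHiK)
open Literature.MathematicalPhysics.QuantumFieldTheory.Balaban1983to89.B7Prop3Flat
open Literature.MathematicalPhysics.QuantumFieldTheory.Balaban1983to89.B7Prop4Flat
open Literature.MathematicalPhysics.QuantumFieldTheory.Balaban1983to89.B7Prop5Flat
open Literature.MathematicalPhysics.QuantumFieldTheory.Balaban1983to89 (B7Transfer.norm_exp_sub_one_le_of_le)

variable {d : ℕ}

/-! ## §1 Calculus plumbing: a complex-line derivative read along the real axis -/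

/-- Restriction of a complex-line derivative to the real axis (vector-valued version of Mathlib's
`HasDerivAt.comp_ofReal`, which is stated for `ℂ → ℂ`). [folklore] -/
theorem hasDerivAt_comp_ofReal {E : Type*} [NormedAddCommGroup E] [NormedSpace ℂ E] {Φ : ℂ → E} {Φ' : E}
    {t : ℝ} (h : HasDerivAt Φ Φ' (t : ℂ)) : HasDerivAt (fun s : ℝ => Φ (s : ℂ)) Φ' t := by
  simpa only [Complex.ofRealCLM_apply, Complex.ofReal_one, one_smul, Function.comp_def] using!
    h.scomp t Complex.ofRealCLM.hasDerivAt

/-- Translating the base point of a line derivative: if `τ ↦ Φ(t₀ + τ)` has derivative `Φ'` at `0`, then `Φ` has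
derivative `Φ'` at `t₀`. [folklore] -/
theorem hasDerivAt_of_shift {E : Type*} [NormedAddCommGroup E] [NormedSpace ℂ E] {Φ : ℂ → E} {Φ' : E} {t₀ : ℂ}
    (h : HasDerivAt (fun τ : ℂ => Φ (t₀ + τ)) Φ' 0) : HasDerivAt Φ Φ' t₀ := by
  have h' : HasDerivAt (fun τ : ℂ => Φ (t₀ + τ)) Φ' (t₀ + -t₀) := by rwa [add_neg_cancel]
  have h5 := h'.comp_add_const t₀ (-t₀)
  refine h5.congr_of_eventuallyEq (Filter.Eventually.of_forall fun x => ?_)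
  show Φ x = Φ (t₀ + (x + -t₀))
  congr 1; ring

section Main

variable {𝔸 : Type*} [NormedRing 𝔸] [NormedAlgebra ℂ 𝔸] [CompleteSpace 𝔸]

/-! ## §2 One fine bond: the segment estimate from b07's per-bond line derivative (156)_B -/

/-- **ONE-BOND VARIATION OF THE `k`-FOLD AVERAGE** (the segment step of the bridge): inside b07's polydisc
(`sup_b ‖B_b‖ ≤ b`, `C₃(d,L)·L^k·b ≤ 1`, `L ≥ 2`), switching ON one fine bond variable `X` (`‖X‖ ≤ b`) at a bond `⟨y, y+e_μ⟩`
where `B` vanishes moves EVERY `k`-fold averaged logarithmic bond variable `Q_k(1, ·)(c)` by at most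
`(L^k·L^{−kd} + C₃(L^k)²L^{−kd}b)·‖X‖` — the per-entry bound of [Balaban1985Averaging] Prop. 5 (156) at `U₀ = 1` in
`B`-variables (`B7Prop5Flat.prop5_flat_156_B`: the line derivative of `B′ ↦ Q_k(1, B′)(c)` in the direction `X·δ_b`)
integrated along the real segment `t ∈ [0,1] ↦ B + t·X·δ_b`, which stays in the polydisc (mean-value inequality,
`norm_image_sub_le_of_norm_deriv_le_segment_01'`). [folklore] -/
theorem norm_logIter_add_bump_sub_le (L : ℕ) (hL : 2 ≤ L) (B : Site d → Fin d → 𝔸) {b : ℝ} (hb : 0 ≤ b)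
    (hB : ∀ x κ, ‖B x κ‖ ≤ b) (k : ℕ) (hk : C3 d L * ((L : ℝ) ^ k * b) ≤ 1) (y : Site d) (μ : Fin d)
    (hy : B y μ = 0) (X : 𝔸) (hX : ‖X‖ ≤ b) (z : Site d) (κ : Fin d) :
    ‖logIter L (B + bump y μ X) k z κ - logIter L B k z κ‖
      ≤ ((L : ℝ) ^ k * (((L : ℝ) ^ k) ^ d)⁻¹ + K5 d L b k) * ‖X‖ := by
  set D : Site d → Fin d → 𝔸 := bump y μ X with hD
  set Φ : ℂ → 𝔸 := fun τ => logIter L (B + τ • D) k z κ with hΦ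
  set F' : ℝ → 𝔸 := fun t => dC L (B + (t : ℂ) • D) D k z κ + linQIter L D k z κ with hF'
  -- the real segment stays inside the polydisc
  have hpoly : ∀ t : ℝ, t ∈ Icc (0 : ℝ) 1 → ∀ x κ', ‖(B + (t : ℂ) • D) x κ'‖ ≤ b := by
    intro t ht x κ'
    simp only [Pi.add_apply, Pi.smul_apply, hD, bump]
    split_ifs with h
    · obtain ⟨rfl, rfl⟩ := h
      rw [hy, zero_add, norm_smul, Complex.norm_real, Real.norm_eq_abs, abs_of_nonneg ht.1]
      calc t * ‖X‖ ≤ 1 * ‖X‖ := mul_le_mul_of_nonneg_right ht.2 (norm_nonneg _)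
        _ ≤ b := by rw [one_mul]; exact hX
    · rw [smul_zero, add_zero]; exact hB x κ'
  -- b07's per-bond line derivative at every point of the segment, transported to the base point `t`
  have hderC : ∀ t : ℝ, t ∈ Icc (0 : ℝ) 1 →
      HasDerivAt Φ (F' t) (t : ℂ) ∧ ‖F' t‖ ≤ ((L : ℝ) ^ k * (((L : ℝ) ^ k) ^ d)⁻¹ + K5 d L b k) * ‖X‖ := by
    intro t ht
    obtain ⟨h1, h2⟩ := prop5_flat_156_B L hL (B + (t : ℂ) • D) hb (hpoly t ht) k hk y μ X z κ
    refine ⟨hasDerivAt_of_shift ?_, h2⟩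
    have h1' : HasDerivAt (fun τ : ℂ => logIter L (B + (t : ℂ) • D + τ • D) k z κ) (F' t) 0 := h1
    refine h1'.congr_of_eventuallyEq (Filter.Eventually.of_forall fun τ => ?_)
    show Φ ((t : ℂ) + τ) = logIter L (B + (t : ℂ) • D + τ • D) k z κ
    simp only [hΦ, add_smul, add_assoc]
  -- read along the real axis and apply the mean-value inequality on `[0, 1]`
  have hderR : ∀ t ∈ Icc (0 : ℝ) 1, HasDerivWithinAt (fun s : ℝ => Φ (s : ℂ)) (F' t) (Icc (0 : ℝ) 1) t :=
    fun t ht => (hasDerivAt_comp_ofReal (hderC t ht).1).hasDerivWithinAt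
  have hmv := norm_image_sub_le_of_norm_deriv_le_segment_01' hderR
    (fun t ht => (hderC t (Ico_subset_Icc_self ht)).2)
  have h1 : Φ ((1 : ℝ) : ℂ) = logIter L (B + D) k z κ := by
    simp only [hΦ, Complex.ofReal_one, one_smul]
  have h0 : Φ ((0 : ℝ) : ℂ) = logIter L B k z κ := by
    simp only [hΦ, Complex.ofReal_zero, zero_smul, add_zero]
  rw [h1, h0] at hmv
  exact hmv

/-- **LOCALITY OF THE ONE-BOND VARIATION** (p. 24 after (43), p. 31: `U̿^k_c` «depends only on the bond variables
`U_b` for `b ⊂ B^k(c₋) ∪ B^k(c₊)`»; kernel: b07's `logIter_congr`): switching on a bond variable at a fine bond NOT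
contained in the box `[L^kz, L^kz + (L^k − 1)𝟙 + L^ke_κ]` of the coarse bond `c = ⟨L^kz, L^kz + L^ke_κ⟩` does not move
`Q_k(1, ·)(c)` at all. [cite: Balaban1985Averaging, p.24 (after (43)), p.31 (after (91))] -/
theorem logIter_add_bump_eq_of_not_bondIn (L : ℕ) (hL : 1 ≤ L) (B : Site d → Fin d → 𝔸) (k : ℕ) (y : Site d)
    (μ : Fin d) (X : 𝔸) (z : Site d) (κ : Fin d) (hnot : ¬ BondIn (loK L k z) (bondHiK L k z κ) y μ) :
    logIter L (B + bump y μ X) k z κ = logIter L B k z κ := by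
  refine logIter_congr L hL k z κ fun x ν hx hxe => ?_
  rw [Pi.add_apply, Pi.add_apply, bump_eq_zero_of X fun h => ?_, add_zero]
  obtain ⟨rfl, rfl⟩ := h
  exact hnot ⟨hx, hxe⟩

/-! ## §3 THE ℓ¹ FORM OF (156) AT `U₀ = 1`: telescoping over the support -/

open scoped Classical in
/-- **THE ℓ¹ ∕ SEGMENT FORM OF [Balaban1985Averaging] PROP. 5 (156) AT THE FLAT BACKGROUND, LOCAL VERSION, for the
concrete `k`-fold double-bar averaging `Q_k(1, ·)` (127) of the B7 fold on `ℤ^d`** — p. 42: «|(δ/δA_b) Q_k(U₀, ηA, c)| ≤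
1 + 2C′₁α₀ + C₃|A|» (per entry; PROVED per bond at `U₀ = 1` by `B7Prop5Flat.prop5_flat_156_B`) and p. 24: the average
«depends only on the bond variables `U_b` for `b ⊂ B^k(c₋) ∪ B^k(c₊)`», SUMMED: for `L ≥ 2`, `sup_b ‖B_b‖ ≤ b`,
`C₃(d,L)·L^k·b ≤ 1` and `B` vanishing off a finite set `Λ` of unit-lattice bonds, at EVERY bond
`c = ⟨L^kz, L^kz + L^ke_κ⟩` of the `L^k`-lattice

  `‖Q_k(1, B)(c)‖ ≤ (L^k·L^{−kd} + C₃(L^k)²L^{−kd}·b) · Σ_{b ∈ Λ, b ⊂ B^k(c₋)∪B^k(c₊)} ‖B_b‖`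

(`= (1 + C₃L^kb)·L^{(1−d)k}·Σ‖B_b‖` over the bonds of the support INSIDE the box of `c`; in particular `Q_k(1,B)(c) = 0`
when the box misses the support), uniformly in `k`.  Proof: induction on `Λ`, switching the bond variables on one at a
time from `Q_k(1, 0) = 0` (`logIter_zero_field`): a bond inside the box costs §2's segment bound, a bond outside costs
nothing (locality); every intermediate configuration lies in the polydisc.  This is the per-coarse-bond deviation shape
`BondDevBound` of `Spine/NE7/QLaHolonomyDefect` §1b (rate `θ = L^{1−d}` per step, constant `1 + C₃L^kb ≤ 2`) for
Bałaban's averaging in the B7 fold's coordinates — the frames (110) of the double-bar average being the coarse gauge.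
[cite: Balaban1985Averaging, Prop. 5 (156) p.42, (137)–(138) p.39, (127) p.37, p.24 (after (43))] -/
theorem norm_logIter_le_l1_local (L : ℕ) (hL : 2 ≤ L) {b : ℝ} (hb : 0 ≤ b) (k : ℕ)
    (hk : C3 d L * ((L : ℝ) ^ k * b) ≤ 1) (Λ : Finset (Site d × Fin d)) :
    ∀ B : Site d → Fin d → 𝔸, (∀ x κ, ‖B x κ‖ ≤ b) → (∀ x κ, (x, κ) ∉ Λ → B x κ = 0) →
      ∀ (z : Site d) (κ : Fin d),
        ‖logIter L B k z κ‖ ≤ ((L : ℝ) ^ k * (((L : ℝ) ^ k) ^ d)⁻¹ + K5 d L b k) *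
          ∑ s ∈ Λ.filter (fun s => BondIn (loK L k z) (bondHiK L k z κ) s.1 s.2), ‖B s.1 s.2‖ := by
  classical
  have hL1 : 1 ≤ L := le_trans (by norm_num) hL
  set M : ℝ := (L : ℝ) ^ k * (((L : ℝ) ^ k) ^ d)⁻¹ + K5 d L b k with hM
  refine Finset.induction_on Λ ?_ ?_
  · intro B _ hoff z κ
    have hB0 : B = 0 := by
      funext x κ'; exact hoff x κ' (Finset.notMem_empty _)
    rw [hB0, logIter_zero_field L hL1 k]
    simp
  · intro s Λ hs ih B hB hoff z κ
    -- switch off the bond `s`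
    set B' : Site d → Fin d → 𝔸 := fun x κ' => if x = s.1 ∧ κ' = s.2 then 0 else B x κ' with hB'def
    have hB'poly : ∀ x κ', ‖B' x κ'‖ ≤ b := by
      intro x κ'; simp only [hB'def]
      split_ifs
      · rw [norm_zero]; exact hb
      · exact hB x κ'
    have hB'off : ∀ x κ', (x, κ') ∉ Λ → B' x κ' = 0 := by
      intro x κ' hx
      simp only [hB'def]
      split_ifs with h
      · rfl
      · refine hoff x κ' fun hmem => ?_
        rcases Finset.mem_insert.1 hmem with h' | h'
        · exact h ⟨congrArg Prod.fst h', congrArg Prod.snd h'⟩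
        · exact hx h'
    have hB's : B' s.1 s.2 = 0 := by simp [hB'def]
    have hdecomp : B' + bump s.1 s.2 (B s.1 s.2) = B := by
      funext x κ'
      simp only [Pi.add_apply, hB'def, bump]
      split_ifs with h
      · obtain ⟨h1, h2⟩ := h; rw [h1, h2, zero_add]
      · rw [add_zero]
    set p : Site d × Fin d → Prop := fun t => BondIn (loK L k z) (bondHiK L k z κ) t.1 t.2 with hp
    have hsum : ∑ t ∈ Λ.filter p, ‖B' t.1 t.2‖ = ∑ t ∈ Λ.filter p, ‖B t.1 t.2‖ := by
      refine Finset.sum_congr rfl fun t ht => ?_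
      have htΛ : t ∈ Λ := (Finset.mem_filter.1 ht).1
      have hts : ¬(t.1 = s.1 ∧ t.2 = s.2) := fun h => hs (by rwa [← Prod.ext h.1 h.2])
      simp only [hB'def, if_neg hts]
    have h1 := ih B' hB'poly hB'off z κ
    rw [hsum] at h1
    by_cases hin : p s
    · -- the bond lies in the box of `c`: §2's segment bound
      have h2 := norm_logIter_add_bump_sub_le L hL B' hb hB'poly k hk s.1 s.2 hB's (B s.1 s.2) (hB s.1 s.2) z κ
      rw [hdecomp] at h2
      have hs' : s ∉ Λ.filter p := fun h => hs (Finset.mem_filter.1 h).1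
      rw [Finset.filter_insert, if_pos hin, Finset.sum_insert hs', mul_add]
      calc ‖logIter L B k z κ‖
          ≤ ‖logIter L B k z κ - logIter L B' k z κ‖ + ‖logIter L B' k z κ‖ := norm_le_norm_sub_add _ _
        _ ≤ M * ‖B s.1 s.2‖ + M * ∑ t ∈ Λ.filter p, ‖B t.1 t.2‖ := add_le_add h2 h1
    · -- the bond lies outside the box of `c`: locality, no cost
      have heq : logIter L B k z κ = logIter L B' k z κ := by
        rw [← hdecomp]; exact logIter_add_bump_eq_of_not_bondIn L hL1 B' k s.1 s.2 (B s.1 s.2) z κ hin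
      rw [Finset.filter_insert, if_neg hin, heq]
      exact h1

/-- **THE ℓ¹ FORM OF (156) AT `U₀ = 1`, GLOBAL VERSION**: as above with the sum over the whole support `Λ` —
`‖Q_k(1, B)(c)‖ ≤ (1 + C₃L^kb)·L^{(1−d)k}·Σ_{b∈Λ}‖B_b‖` at every coarse bond `c`, uniformly in `k`.
[cite: Balaban1985Averaging, Prop. 5 (156) p.42, (137)–(138) p.39, (127) p.37] -/
theorem norm_logIter_le_l1 (L : ℕ) (hL : 2 ≤ L) {b : ℝ} (hb : 0 ≤ b) (k : ℕ)
    (hk : C3 d L * ((L : ℝ) ^ k * b) ≤ 1) (Λ : Finset (Site d × Fin d)) (B : Site d → Fin d → 𝔸)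
    (hB : ∀ x κ, ‖B x κ‖ ≤ b) (hoff : ∀ x κ, (x, κ) ∉ Λ → B x κ = 0) (z : Site d) (κ : Fin d) :
    ‖logIter L B k z κ‖ ≤ ((L : ℝ) ^ k * (((L : ℝ) ^ k) ^ d)⁻¹ + K5 d L b k) * ∑ s ∈ Λ, ‖B s.1 s.2‖ := by
  classical
  refine (norm_logIter_le_l1_local L hL hb k hk Λ B hB hoff z κ).trans (mul_le_mul_of_nonneg_left ?_ ?_)
  · exact Finset.sum_le_sum_of_subset_of_nonneg (Finset.filter_subset _ _) fun _ _ _ => norm_nonneg _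
  · exact add_nonneg (by positivity) (K5_nonneg d L hb k)

/-- The constant of §3 in closed form: `L^k·L^{−kd} + C₃(L^k)²L^{−kd}·b = (1 + C₃·L^k·b)·(L^k·L^{−kd})`, and
`L^k·L^{−kd} = (L^{d−1})^{−k}` = NE1a's printed per-step rate `θ₁ = L^{1−d}` to the power `k` (for `d ≥ 1`); under the
smallness `C₃L^kb ≤ 1` the prefactor is `≤ 2`. [folklore] -/
theorem l1Const_eq (L : ℕ) (hL : 1 ≤ L) (hd : 1 ≤ d) (b : ℝ) (k : ℕ) :
    (L : ℝ) ^ k * (((L : ℝ) ^ k) ^ d)⁻¹ + K5 d L b k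
      = (1 + C3 d L * ((L : ℝ) ^ k * b)) * ((((L : ℝ) ^ (d - 1))⁻¹) ^ k) := by
  have hL0 : (L : ℝ) ≠ 0 := by exact_mod_cast (show L ≠ 0 by omega)
  have hLk : (L : ℝ) ^ k ≠ 0 := pow_ne_zero _ hL0
  obtain ⟨d', rfl⟩ : ∃ d', d = d' + 1 := ⟨d - 1, by omega⟩
  have hLd : (L : ℝ) ^ d' ≠ 0 := pow_ne_zero _ hL0
  have hLdk : ((L : ℝ) ^ d') ^ k ≠ 0 := pow_ne_zero _ hLd
  have hpow : ((L : ℝ) ^ k) ^ (d' + 1) = ((L : ℝ) ^ d') ^ k * (L : ℝ) ^ k := by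
    rw [pow_succ, ← pow_mul, ← pow_mul, mul_comm k d']
  simp only [Nat.add_sub_cancel, K5, inv_pow, hpow]
  field_simp

/-- `… ≤ 2·θ₁^k·Σ‖B_b‖`: the ℓ¹ bound with the prefactor `1 + C₃L^kb ≤ 2` and the rate made explicit (`d ≥ 1`).
[folklore] -/
theorem norm_logIter_le_two_mul_rate (L : ℕ) (hL : 2 ≤ L) (hd : 1 ≤ d) {b : ℝ} (hb : 0 ≤ b) (k : ℕ)
    (hk : C3 d L * ((L : ℝ) ^ k * b) ≤ 1) (Λ : Finset (Site d × Fin d)) (B : Site d → Fin d → 𝔸)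
    (hB : ∀ x κ, ‖B x κ‖ ≤ b) (hoff : ∀ x κ, (x, κ) ∉ Λ → B x κ = 0) (z : Site d) (κ : Fin d) :
    ‖logIter L B k z κ‖ ≤ 2 * ((((L : ℝ) ^ (d - 1))⁻¹) ^ k) * ∑ s ∈ Λ, ‖B s.1 s.2‖ := by
  have hL1 : 1 ≤ L := le_trans (by norm_num) hL
  have h := norm_logIter_le_l1 L hL hb k hk Λ B hB hoff z κ
  rw [l1Const_eq L hL1 hd b k] at h
  refine h.trans (mul_le_mul_of_nonneg_right ?_ (Finset.sum_nonneg fun _ _ => norm_nonneg _))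
  refine mul_le_mul_of_nonneg_right (by linarith) (by positivity)

/-- **SUPPORT FORM** (the currency of `QLaHolonomyDefect.holDev_le_of_support`): if `B` vanishes off `Λ` and
`‖B_b‖ ≤ D` on `Λ`, then EVERY `k`-fold averaged logarithmic bond variable is within `(1 + C₃L^kb)·L^{(1−d)k}·|Λ|·D`
of zero. [folklore] -/
theorem norm_logIter_le_card_mul (L : ℕ) (hL : 2 ≤ L) {b : ℝ} (hb : 0 ≤ b) (k : ℕ)
    (hk : C3 d L * ((L : ℝ) ^ k * b) ≤ 1) (Λ : Finset (Site d × Fin d)) (B : Site d → Fin d → 𝔸)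
    (hB : ∀ x κ, ‖B x κ‖ ≤ b) (hoff : ∀ x κ, (x, κ) ∉ Λ → B x κ = 0) {D : ℝ}
    (hD : ∀ s ∈ Λ, ‖B s.1 s.2‖ ≤ D) (z : Site d) (κ : Fin d) :
    ‖logIter L B k z κ‖ ≤ ((L : ℝ) ^ k * (((L : ℝ) ^ k) ^ d)⁻¹ + K5 d L b k) * (Λ.card * D) := by
  have h := norm_logIter_le_l1 L hL hb k hk Λ B hB hoff z κ
  refine h.trans (mul_le_mul_of_nonneg_left ?_ ?_)
  · calc ∑ s ∈ Λ, ‖B s.1 s.2‖ ≤ ∑ _s ∈ Λ, D := Finset.sum_le_sum hD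
      _ = Λ.card * D := by rw [Finset.sum_const, nsmul_eq_mul]
  · exact add_nonneg (by positivity) (K5_nonneg d L hb k)

/-! ## §4 On the group: the `k`-fold averaged bond variable itself is near the identity -/

/-- b07's smallness `C₃L^kb ≤ 1` implies Prop. 4's `L^kb ≤ c₄(d)` and `2L^kb ≤ 1` — bookkeeping on the printed
constants `C₃ = 128(d+1)C₁L^d ≥ 32C₁`, `c₄ = 1/(8C₁)`, `C₁ = 1256(d+1)² ≥ 1`. [folklore] -/
theorem smallness_of_C3 (L : ℕ) (hL : 1 ≤ L) {b : ℝ} (hb : 0 ≤ b) (k : ℕ)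
    (hk : C3 d L * ((L : ℝ) ^ k * b) ≤ 1) :
    (L : ℝ) ^ k * b ≤ c4 d ∧ 2 * ((L : ℝ) ^ k * b) ≤ 1 := by
  have hC1 := C1_pos d
  have hC1' : (1 : ℝ) ≤ C1 d := by
    have : (0 : ℝ) ≤ d := Nat.cast_nonneg d
    unfold C1; nlinarith
  have ht : 0 ≤ (L : ℝ) ^ k * b := by positivity
  have h32 := small32_of_C3 d L hL ht hk
  constructor
  · rw [c4, le_div_iff₀ (by positivity)]
    nlinarith
  · nlinarith

/-- **THE AVERAGED BOND VARIABLE ON THE GROUP**: under the same hypotheses, the concrete `k`-fold double-bar average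
`U̿₁^k(c)` of `U₁ = e^{B}` ((90)–(91), `B7Prop4Flat.dbavgIter`) equals `exp Q_k(1, B)(c)` (b07∕Prop. 4:
`dbavgIter_eq_expCfg_logIter`) and is within `2·(1 + C₃L^kb)·L^{(1−d)k}·Σ_{b∈Λ}‖B_b‖` of the identity — the literal
content of `BondDevBound` (distance of the averaged bond variable to `1`, coarse gauge = the frames) for Bałaban's
averaging at the flat background on `ℤ^d`. [cite: Balaban1985Averaging, Prop. 5 (156) p.42, (90)–(91) p.31, (161) p.42] -/
theorem norm_dbavgIter_sub_one_le (L : ℕ) (hL : 2 ≤ L) {b : ℝ} (hb : 0 ≤ b) (k : ℕ)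
    (hk : C3 d L * ((L : ℝ) ^ k * b) ≤ 1) (Λ : Finset (Site d × Fin d)) (B : Site d → Fin d → 𝔸)
    (hB : ∀ x κ, ‖B x κ‖ ≤ b) (hoff : ∀ x κ, (x, κ) ∉ Λ → B x κ = 0) (z : Site d) (κ : Fin d) :
    ‖((dbavgIter L (expCfg B) k z κ : 𝔸ˣ) : 𝔸) - 1‖
      ≤ 2 * (((L : ℝ) ^ k * (((L : ℝ) ^ k) ^ d)⁻¹ + K5 d L b k) * ∑ s ∈ Λ, ‖B s.1 s.2‖) := by
  have hL1 : 1 ≤ L := le_trans (by norm_num) hL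
  obtain ⟨hc4, h2b⟩ := smallness_of_C3 L hL1 hb k hk
  have hval : ((dbavgIter L (expCfg B) k z κ : 𝔸ˣ) : 𝔸) = exp (logIter L B k z κ) := by
    rw [dbavgIter_eq_expCfg_logIter L hL B hb hB k hc4 le_rfl]; rfl
  -- the sup bound (131): `‖Q_k(1,B)(c)‖ ≤ 2L^kb ≤ 1`
  have hC1 := C1_pos d
  have hk8 : 8 * C1 d * ((L : ℝ) ^ k * b) ≤ 1 := by
    have h := mul_le_mul_of_nonneg_left hc4 (by positivity : (0 : ℝ) ≤ 8 * C1 d)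
    rwa [c4, mul_one_div_cancel (by positivity)] at h
  have hsup : ‖logIter L B k z κ‖ ≤ 1 :=
    ((prop4_flat_induction L hL B hb hB k hk8 k le_rfl).2.2 z κ).trans h2b
  have hl1 := norm_logIter_le_l1 L hL hb k hk Λ B hB hoff z κ
  -- `e^x − 1 ≤ 2x` on `[0, 1]` (the tree's `exp_sub_one_le_two_mul`, inlined to keep the import list to `B7Prop5Flat`)
  have hexp : ∀ {x : ℝ}, 0 ≤ x → x ≤ 1 → Real.exp x - 1 ≤ 2 * x := fun {x} h0 h1 => by
    have h := Real.abs_exp_sub_one_sub_id_le (by rwa [abs_of_nonneg h0] : |x| ≤ 1)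
    have h' : Real.exp x - 1 - x ≤ x ^ 2 := (le_abs_self _).trans h
    nlinarith
  rw [hval]
  calc ‖exp (logIter L B k z κ) - 1‖ ≤ Real.exp ‖logIter L B k z κ‖ - 1 :=
        B7Transfer.norm_exp_sub_one_le_of_le _ le_rfl
    _ ≤ 2 * ‖logIter L B k z κ‖ := hexp (norm_nonneg _) hsup
    _ ≤ _ := mul_le_mul_of_nonneg_left hl1 (by norm_num)

/-! ## §5 The printed normalisation: (156) + (138) summed -/

/-- **(156) SUMMED, PRINTED VARIABLES** (`U₀ = 1`, `η = L^{−k}`, `sup_b |A_b| ≤ a`, `C₃(d,L)·a ≤ 1`, `A` vanishing off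
`Λ`): `‖Q_k(U₀, ηA)(c)‖ ≤ (1 + C₃a) · Σ_{b∈Λ} η^d ‖A_b‖` — the printed per-entry constant `1 + 2C′₁α₀ + C₃|A|` of (156)
(`α₀ = 0`) times the `η^d`-weighted ℓ¹ norm of `A`, which is (138)'s «Σ_b η^d tr(δF∕δA_b · δA_b)» integrated from the
flat configuration. [cite: Balaban1985Averaging, Prop. 5 (156) p.42, (138) p.39] -/
theorem norm_logIter_le_l1_printed (L : ℕ) (hL : 2 ≤ L) (k : ℕ) {a : ℝ} (ha : 0 ≤ a) (hak : C3 d L * a ≤ 1)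
    (Λ : Finset (Site d × Fin d)) (A : Site d → Fin d → 𝔸) (hA : ∀ x κ, ‖A x κ‖ ≤ a)
    (hoff : ∀ x κ, (x, κ) ∉ Λ → A x κ = 0) (z : Site d) (κ : Fin d) :
    ‖logIter L ((((L : ℝ) ^ k)⁻¹) • A) k z κ‖
      ≤ (1 + C3 d L * a) * ∑ s ∈ Λ, (((L : ℝ) ^ k)⁻¹) ^ d * ‖A s.1 s.2‖ := by
  have hL1 : 1 ≤ L := le_trans (by norm_num) hL
  have hL0 : (0 : ℝ) < L := by exact_mod_cast (show 0 < L from hL1)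
  set η : ℝ := ((L : ℝ) ^ k)⁻¹ with hη
  have hη0 : 0 < η := by positivity
  have hLη : (L : ℝ) ^ k * η = 1 := mul_inv_cancel₀ (by positivity)
  have hB : ∀ x κ', ‖(η • A) x κ'‖ ≤ η * a := fun x κ' => by
    rw [Pi.smul_apply, Pi.smul_apply, norm_real_smul η hη0.le]
    exact mul_le_mul_of_nonneg_left (hA x κ') hη0.le
  have hoffB : ∀ x κ', (x, κ') ∉ Λ → (η • A) x κ' = 0 := fun x κ' hx => by
    rw [Pi.smul_apply, Pi.smul_apply, hoff x κ' hx, smul_zero]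
  have hk : C3 d L * ((L : ℝ) ^ k * (η * a)) ≤ 1 := by
    have h1 : (L : ℝ) ^ k * (η * a) = a := by rw [← mul_assoc, hLη, one_mul]
    rw [h1]; exact hak
  have h := norm_logIter_le_l1 L hL (by positivity) k hk Λ (η • A) hB hoffB z κ
  refine h.trans (le_of_eq ?_)
  rw [Finset.mul_sum, Finset.mul_sum]
  refine Finset.sum_congr rfl fun s _ => ?_
  rw [Pi.smul_apply, Pi.smul_apply, norm_real_smul η hη0.le, K5, ← inv_pow, ← hη]
  have : (L : ℝ) ^ k * η = 1 := hLη
  calc ((L : ℝ) ^ k * η ^ d + C3 d L * ((L : ℝ) ^ k) ^ 2 * η ^ d * (η * a)) * (η * ‖A s.1 s.2‖)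
      = (((L : ℝ) ^ k * η) + C3 d L * a * ((L : ℝ) ^ k * η) ^ 2) * (η ^ d * ‖A s.1 s.2‖) := by ring
    _ = (1 + C3 d L * a) * (η ^ d * ‖A s.1 s.2‖) := by rw [this, one_pow, mul_one]

end Main

end Summit.QuantumFields.BalabanUV.T4Continuum.Spine.NE7.B7Flat

end
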